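import Summits.BirchSwinnertonDyer.BirchSwinnertonDyer.Theorems.ErratumRoadFiveTwistedPeriodicFunctions
import Mathlib.Topology.Instances.AddCircle.Defs
import HarnessLib

/-!
# The value `(x mod 2^k)·2^{-k} ∈ ℚ/ℤ` of a `ℤ_p`-adic number read at level `k`: level change and well-definedness arithmetic
# (the `ℚ/ℤ`-arithmetic behind the value character `pair₂` of the 22608 line, stub S2 `stub_plusColemanO`)

Route `ResidualThetaTransportAtTwo` (RTT), crux RSL_g `ResidualSignedLambdaLowerCMAtTwo` (stmt-BirchSwinnertonDyer-22608); seat `prover-bsd-wall-rtt-p2` g17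
(`--supports`, closes nothing). THEOREMS ONLY, pure arithmetic (`ℤ_[p]`, `ZMod`, `AddCircle (1 : ℚ)`); BSD is not proved by any of this.

The value character of skeleton v2b's S2 reads a `ℤ_p`-valued functional `t` on a Kummer representative `(Q, k)` (`p^k Q` a tower point) as
`v_k(x) := (x mod p^k).val • (p^k)⁻¹ ∈ ℚ/ℤ`, `x = t(p^k Q)`. This file proves the three arithmetic facts its well-definedness and additivity need:
* `levelValue_eq_of_toZModPow_eq` — `v_k` depends on `x mod p^k` only;
* `levelValue_mul_pow` — LEVEL CHANGE: `v_{k+j}(p^j x) = v_k(x)` (replacing `(Q, k)` by `(Q, k+j)` multiplies `x` by `p^j`);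
* `levelValue_eq_of_pow_mul_sub_mem` — WELL-DEFINEDNESS: if `p^{k'+e} x − p^{k+e} x' ∈ p^{k+k'+e} ℤ_p` then `v_k(x) = v_{k'}(x')`
  (two Kummer representatives of one class differ by a tower point `R` and a torsion term killed by `p^e`: `p^{k'+e}·t(p^kQ) − p^{k+e}·t(p^{k'}Q') = p^{k+k'+e} t(R)`);
* `levelValue_add` — `v_k(x + y) = v_k(x) + v_k(y)`.

References: [Kobayashi2003] (8.23) (p. 18) (the layer pairing with values in `ℤ/p^k ≅ p^{-k}ℤ/ℤ`); [MilneADT2006] Ch. I §6 (Kummer pairing values in `ℚ/ℤ`).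
-/

set_option autoImplicit false
-- the Theorems namespace of this sub repeats the summit name by design (D-0017 nested layout)
set_option linter.dupNamespace false

namespace Summit.BirchSwinnertonDyer.BirchSwinnertonDyer.Theorems.PlusValue

variable {p : ℕ} [hp : Fact p.Prime]

/-- An INTEGER lies in `p^K ℤ_p` iff `p^K` divides it. [folklore] -/
theorem intCast_mem_span_pow_iff (K : ℕ) (m : ℤ) : (m : ℤ_[p]) ∈ Ideal.span {(p : ℤ_[p]) ^ K} ↔ ((p : ℤ) ^ K) ∣ m := by
  rw [← PadicInt.ker_toZModPow, RingHom.mem_ker, map_intCast, ZMod.intCast_zmod_eq_zero_iff_dvd, Nat.cast_pow]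

/-- The class of a rational in `ℚ/ℤ` vanishes iff it is an integer. [folklore] -/
theorem addCircle_coe_eq_zero_iff (q : ℚ) : ((q : ℚ) : AddCircle (1 : ℚ)) = 0 ↔ ∃ m : ℤ, (m : ℚ) = q := by
  rw [AddCircle.coe_eq_zero_iff]
  constructor
  · rintro ⟨m, hm⟩
    exact ⟨m, by rw [← hm, zsmul_eq_mul, mul_one]⟩
  · rintro ⟨m, hm⟩
    exact ⟨m, by rw [zsmul_eq_mul, mul_one, hm]⟩

omit hp in
/-- `r • (p^k)⁻¹ = r / p^k` in `ℚ/ℤ`. [folklore] -/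
theorem nsmul_coe_inv_pow (k r : ℕ) :
    (r • ((((p : ℚ) ^ k)⁻¹ : ℚ) : AddCircle (1 : ℚ)) : AddCircle (1 : ℚ)) = (((r : ℚ) / (p : ℚ) ^ k : ℚ) : AddCircle (1 : ℚ)) := by
  rw [← AddCircle.coe_nsmul, nsmul_eq_mul, div_eq_mul_inv]

/-- Two rationals have the same class in `ℚ/ℤ` iff they differ by an integer. [folklore] -/
theorem addCircle_coe_eq_coe_iff (q q' : ℚ) :
    ((q : ℚ) : AddCircle (1 : ℚ)) = ((q' : ℚ) : AddCircle (1 : ℚ)) ↔ ∃ m : ℤ, (m : ℚ) = q - q' := by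
  rw [← sub_eq_zero, ← AddCircle.coe_sub, addCircle_coe_eq_zero_iff]

/-- **The level value depends on `x mod p^k` only.** [folklore] -/
theorem levelValue_eq_of_toZModPow_eq (k : ℕ) {x y : ℤ_[p]} (h : PadicInt.toZModPow k x = PadicInt.toZModPow k y) :
    ((PadicInt.toZModPow k x).val • ((((p : ℚ) ^ k)⁻¹ : ℚ) : AddCircle (1 : ℚ)) : AddCircle (1 : ℚ)) =
      (PadicInt.toZModPow k y).val • ((((p : ℚ) ^ k)⁻¹ : ℚ) : AddCircle (1 : ℚ)) := by
  rw [h]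

/-- **WELL-DEFINEDNESS ARITHMETIC.** If `p^{k'+e}·x − p^{k+e}·x' ∈ p^{k+k'+e} ℤ_p` then `(x mod p^k)·p^{-k} = (x' mod p^{k'})·p^{-k'}` in `ℚ/ℤ`.
[cite: Kobayashi2003, (8.23) (p. 18)] [cite: MilneADT2006, Ch. I §6] -/
theorem levelValue_eq_of_pow_mul_sub_mem (k k' e : ℕ) (x x' : ℤ_[p])
    (h : (p : ℤ_[p]) ^ (k' + e) * x - (p : ℤ_[p]) ^ (k + e) * x' ∈ Ideal.span {(p : ℤ_[p]) ^ (k + k' + e)}) :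
    ((PadicInt.toZModPow k x).val • ((((p : ℚ) ^ k)⁻¹ : ℚ) : AddCircle (1 : ℚ)) : AddCircle (1 : ℚ)) =
      (PadicInt.toZModPow k' x').val • ((((p : ℚ) ^ k')⁻¹ : ℚ) : AddCircle (1 : ℚ)) := by
  set r := (PadicInt.toZModPow k x).val with hr
  set r' := (PadicInt.toZModPow k' x').val with hr'
  have hpq : (p : ℚ) ≠ 0 := Nat.cast_ne_zero.mpr hp.out.ne_zero
  -- the integer `p^{k'+e} r − p^{k+e} r'` is divisible by `p^{k+k'+e}`
  have hx := ErratumThm23TwoVariable.TwistedPeriodic.sub_val_toZModPow_mem k x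
  have hx' := ErratumThm23TwoVariable.TwistedPeriodic.sub_val_toZModPow_mem k' x'
  have hint : (((p : ℤ) ^ (k' + e) * r - (p : ℤ) ^ (k + e) * r' : ℤ) : ℤ_[p]) ∈ Ideal.span {(p : ℤ_[p]) ^ (k + k' + e)} := by
    have h1 : (p : ℤ_[p]) ^ (k' + e) * (x - (r : ℤ_[p])) ∈ Ideal.span {(p : ℤ_[p]) ^ (k + k' + e)} := by
      obtain ⟨c, hc⟩ := Ideal.mem_span_singleton'.mp hx
      rw [← hc, show (p : ℤ_[p]) ^ (k' + e) * (c * (p : ℤ_[p]) ^ k) = c * (p : ℤ_[p]) ^ (k + k' + e) by ring]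
      exact Ideal.mul_mem_left _ _ (Ideal.mem_span_singleton_self _)
    have h2 : (p : ℤ_[p]) ^ (k + e) * (x' - (r' : ℤ_[p])) ∈ Ideal.span {(p : ℤ_[p]) ^ (k + k' + e)} := by
      obtain ⟨c, hc⟩ := Ideal.mem_span_singleton'.mp hx'
      rw [← hc, show (p : ℤ_[p]) ^ (k + e) * (c * (p : ℤ_[p]) ^ k') = c * (p : ℤ_[p]) ^ (k + k' + e) by ring]
      exact Ideal.mul_mem_left _ _ (Ideal.mem_span_singleton_self _)
    have h3 := Ideal.add_mem _ (Ideal.sub_mem _ h h1) h2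
    -- `(p^{k'+e} x − p^{k+e} x') − p^{k'+e}(x − r) + p^{k+e}(x' − r') = p^{k'+e} r − p^{k+e} r'`
    have : (((p : ℤ) ^ (k' + e) * r - (p : ℤ) ^ (k + e) * r' : ℤ) : ℤ_[p]) =
        (p : ℤ_[p]) ^ (k' + e) * x - (p : ℤ_[p]) ^ (k + e) * x' - (p : ℤ_[p]) ^ (k' + e) * (x - (r : ℤ_[p])) +
          (p : ℤ_[p]) ^ (k + e) * (x' - (r' : ℤ_[p])) := by
      push_cast
      ring
    rw [this]
    exact h3
  rw [intCast_mem_span_pow_iff] at hint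
  obtain ⟨m, hm⟩ := hint
  -- in `ℚ`: `r/p^k − r'/p^{k'} = m`... precisely `(p^{k'+e} r − p^{k+e} r') / p^{k+k'+e} = m`
  rw [nsmul_coe_inv_pow, nsmul_coe_inv_pow, addCircle_coe_eq_coe_iff]
  refine ⟨m, ?_⟩
  have hm' : ((p : ℚ) ^ (k' + e) * r - (p : ℚ) ^ (k + e) * r' : ℚ) = (p : ℚ) ^ (k + k' + e) * m := by
    exact_mod_cast hm
  have hpow : (p : ℚ) ^ (k + k' + e) ≠ 0 := pow_ne_zero _ hpq
  field_simp
  -- goal: m * (p^k * p^k') = r * p^k' - r' * p^k  (up to the arrangement `field_simp` chose)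
  have e1 : (p : ℚ) ^ (k + k' + e) = (p : ℚ) ^ k * (p : ℚ) ^ k' * (p : ℚ) ^ e := by rw [pow_add, pow_add]
  have e2 : (p : ℚ) ^ (k' + e) = (p : ℚ) ^ k' * (p : ℚ) ^ e := pow_add _ _ _
  have e3 : (p : ℚ) ^ (k + e) = (p : ℚ) ^ k * (p : ℚ) ^ e := pow_add _ _ _
  rw [e1, e2, e3] at hm'
  have hpe : (p : ℚ) ^ e ≠ 0 := pow_ne_zero _ hpq
  have key : ((m : ℚ) * ((p : ℚ) ^ k * (p : ℚ) ^ k') - ((r : ℚ) * (p : ℚ) ^ k' - (r' : ℚ) * (p : ℚ) ^ k)) * (p : ℚ) ^ e = 0 := by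
    linear_combination -hm'
  rcases mul_eq_zero.mp key with h0 | h0
  · linear_combination h0
  · exact absurd h0 hpe

/-- **LEVEL CHANGE**: reading `p^j·x` at level `k + j` gives the value of `x` at level `k`. [cite: Kobayashi2003, (8.23) (p. 18)] -/
theorem levelValue_mul_pow (k j : ℕ) (x : ℤ_[p]) :
    ((PadicInt.toZModPow (k + j) ((p : ℤ_[p]) ^ j * x)).val • ((((p : ℚ) ^ (k + j))⁻¹ : ℚ) : AddCircle (1 : ℚ)) : AddCircle (1 : ℚ)) =
      (PadicInt.toZModPow k x).val • ((((p : ℚ) ^ k)⁻¹ : ℚ) : AddCircle (1 : ℚ)) := by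
  refine levelValue_eq_of_pow_mul_sub_mem (k + j) k 0 ((p : ℤ_[p]) ^ j * x) x ?_
  have h0 : (p : ℤ_[p]) ^ (k + 0) * ((p : ℤ_[p]) ^ j * x) - (p : ℤ_[p]) ^ (k + j + 0) * x = 0 := by ring
  rw [h0]
  exact Ideal.zero_mem _

/-- `p^k • (p^k)⁻¹ = 0` in `ℚ/ℤ`. [folklore] -/
theorem pow_nsmul_coe_inv_pow (k : ℕ) : ((p ^ k) • ((((p : ℚ) ^ k)⁻¹ : ℚ) : AddCircle (1 : ℚ)) : AddCircle (1 : ℚ)) = 0 := by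
  have hpq : (p : ℚ) ^ k ≠ 0 := pow_ne_zero _ (Nat.cast_ne_zero.mpr hp.out.ne_zero)
  rw [nsmul_coe_inv_pow, addCircle_coe_eq_zero_iff]
  exact ⟨1, by rw [Nat.cast_pow, div_self hpq, Int.cast_one]⟩

/-- `(p^k · q) • (p^k)⁻¹ = 0` in `ℚ/ℤ`. [folklore] -/
theorem mul_pow_nsmul_coe_inv_pow (k q : ℕ) : ((p ^ k * q) • ((((p : ℚ) ^ k)⁻¹ : ℚ) : AddCircle (1 : ℚ)) : AddCircle (1 : ℚ)) = 0 := by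
  rw [mul_nsmul, pow_nsmul_coe_inv_pow, nsmul_zero]

/-- **ADDITIVITY at a common level**: `v_k(x + y) = v_k(x) + v_k(y)` in `ℚ/ℤ` (`(a+b).val ≡ a.val + b.val (mod p^k)` and `p^k • p^{-k} = 0`).
[folklore] -/
theorem levelValue_add (k : ℕ) (x y : ℤ_[p]) :
    ((PadicInt.toZModPow k (x + y)).val • ((((p : ℚ) ^ k)⁻¹ : ℚ) : AddCircle (1 : ℚ)) : AddCircle (1 : ℚ)) =
      (PadicInt.toZModPow k x).val • ((((p : ℚ) ^ k)⁻¹ : ℚ) : AddCircle (1 : ℚ)) +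
        (PadicInt.toZModPow k y).val • ((((p : ℚ) ^ k)⁻¹ : ℚ) : AddCircle (1 : ℚ)) := by
  haveI : NeZero (p ^ k) := ⟨pow_ne_zero k hp.out.ne_zero⟩
  rw [← add_nsmul, map_add, ZMod.val_add]
  set s := (PadicInt.toZModPow k x).val + (PadicInt.toZModPow k y).val with hs
  conv_rhs => rw [← Nat.mod_add_div s (p ^ k), add_nsmul, mul_pow_nsmul_coe_inv_pow, add_zero]

end Summit.BirchSwinnertonDyer.BirchSwinnertonDyer.Theorems.PlusValue
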